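import Summits.ABC.IUTFork.Joshi.Dictionary
import Summits.ABC.IUTFork.Joshi.TestHarness
import Summits.ABC.IUTFork.Joshi.ThetaLociTensorPackets
import HarnessLib

/-!
# DICTIONARY, theta-values loci (block E rows D-09 / D-11; rung LADDER-ABC:A2.E): Joshi's `Θ̃^𝓘_Mochizuki`
# (arXiv:2401.13508v4 Thm-Def 9.8.1.1, typed in `Joshi/ThetaLociTensorPackets.lean`) READ in OUR tensor packets

Dictionary file of the abc-iut cell, branch E (seat abc-iut-E-t22; plan/E/E-PLAN.md R4b/R14: OUR frozen Cor312*/Thm311* decls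
are bound to Joshi's objects ONLY in `Joshi/Dictionary*.lean` / `Joshi/Test*.lean`; this file extends the landed seed
`Joshi/Dictionary.lean`). Source for Joshi's side: arXiv:2401.13508 **v4**, «Preliminary version for comments» — UNREFEREED
(bib `Joshi2024ATS3`; rejected by the IUT author, `Mochizuki2024JoshiReport`); render `HOME/lit/renders/Joshi-arxiv-2401.13508/`,
«p.N l.M». **No side is taken** on [IUTchIII] Cor. 3.12, on Joshi's claims or on Mochizuki's report; the structure `LociReading`
carries DATA ONLY, every compatibility is a separate `def … : Prop` — a CANDIDATE HYPOTHESIS with its sentence and locator,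
`@[claim "Joshi2024ATS3" "disputed"]` when print asserts it (as a correspondence), plainly labelled «OUR READING» when it is our
dictionary gloss — never an axiom, instance, `sorry` or Literature fact. The theorems are kernel glue (logic only). TYPED ≠
PROVED ≠ ENDORSED; a chain ending in `P.Statement` below reads «Statement follows from the named candidate hypotheses», no more.

WHAT IS BOUND. Print (Thm-Def 9.8.1.1 (7), p.116 l.25–50): the loci `Θ̃^{Ĩ}_Mochizuki ⊂ Ĩ_Mochizuki`, `Θ̃^{𝓘}_Mochizuki ⊂
𝓘_Mochizuki` «are Mochizuki's multi-radial representations of Theta-values i.e. the Theta-values locii of [Mochizuki, 2021c,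
Theorem 3.11, Corollary 3.12]»; §9.4 (Def. 9.4.6.7 p.104 l.40–44): `𝓘_Mochizuki(L′) = ∏_p ∏_{j=1}^{ℓ*} S_{j+1}𝓘_p(L′)` «Mochizuki's
adelic tensor product log-shell … [Mochizuki, 2021c, Theorem 3.11(i)(c)]»; Rmk. 9.4.11.2 (p.107 l.20–24): «this construction is
carried out in [Mochizuki, 2021c, Proposition 3.1] and 𝓘_Mochizuki is called the holomorphic log-shell … [resp.] Proposition 3.2
… mono-analytic log-shell». OUR side (Cor312Statement / Thm311Sig): the tensor packet `S.L.Packet j vQ =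
𝓘^ℚ(^{S^±_{j+1}};^{n,∘}𝒟^⊢_{v_ℚ})` (Prop. 3.2; `Caps j = S_{j+1}`), the possible images `P.possibleImages j vQ` of the Θ-pilot
(translates of the (Ind3)-enlarged region by `Subgroup.closure (Ind1Family ∪ Ind2Family)`), their holomorphic hull
`P.thetaHull j vQ = ^{n,∘}𝒰_{j,v_ℚ}`, the q-pilot region `P.qRegion j vQ`, and the hull-level licence `Thm311ToCor312.Licence P`
(«the q-pilot region lies in ^{n,∘}𝒰 at every label of 𝔽_l^⋇», (xi-f) p.184) with `statement_of_licence`.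

ROWS. D-09 `LociReading.proj j vQ : TM → S.L.Packet j vQ` — the `(v_ℚ, j)`-factor of Joshi's tensor codomain `𝓘^ℚ_Mochizuki`
(parameter `TM` of `ATS3.TensorPacketLociDatum`) READ AS our packet (data; the typer of §9.4, T-20, refines it); D-02 concordance
`LociReading.pt : C.Z → 𝔇.Pt`, `pt z_Θ = 𝔇.std` (the two typings of `Σ̃_{L′}`: the loci signature's index type and the seed's
`Dictionary.Pt`). D-11 `LocusWithinPossibleImages` / `PossibleImagesWithinLocus` (the two halves of print's «are»),
`LocusWithinHull` (the hull-level weakening, what (xi-f) consumes); OUR READINGS `StdDatumWithinLocus` (the standard point's Kummer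
datum, row D-03/D-06 of the seed, is read INSIDE the projected locus — print: `z_Θ ∈ Σ̃_{L′}`, so `log_BK(ξ_{z_Θ}) ∈ Ψ ⊂ Θ̃`,
Thm-Def 9.8.1.1 (4)/(5) with §4.5) and `GeneratorsReadAsData` (D-03/D-09 concordance). D-10 (collation isomorphisms ↦
`⟨Ind1 ∪ Ind2⟩`) is the seed's `MovesAreInd`, whose `Move` covers the collation isomorphisms of Prop. 9.7.5.1 by its docstring;
D-12 is the seed's `StandardPointIsQPilot` (graded STRONGER-THAN-PRINT, E-PLAN R15) / `StandardPointHasQPilotVolume`.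

GLUE (logic only): `LocusWithinPossibleImages → LocusWithinHull`; `LocusWithinHull ∧ StdDatumWithinLocus ∧ StandardPointIsQPilot ∧
QPinned → Licence P` (hence `P.Statement` under `BridgeHyps`, `statement_of_licence`) — an S-BYPASSING, HULL-LEVEL chain (E-PLAN R9:
reported as such, never as FILLS; it carries R15's grade of `StandardPointIsQPilot` verbatim); and the pointwise-cover consequence
`qRegion ⊆ ⋃₀ possibleImages` of the identification-level row, which is WEAKER than S (`PilotKummerIndRelated` asks ONE `D′ ∈ ^{n,∘}ℜ^LGP`
uniformly) and than `IndCoversQ` (one translate per packet) — recorded so the test ledger can place it. Nothing here is a TEST line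
(E-cx rules shapes; ThmDef 9.8.1.1 (7) itself gets no TEST line, R14). [claim: Joshi2024ATS3, status: disputed]
-/

noncomputable section

open Set

namespace Summit.ABC.IUTFork.Joshi

open Thm311 Cor312 Cor312Vol

variable {T : ThetaIndex} {S : LatticeSituation T} {P : Cor312.Setting S.toSituation}
  (ρ : (∀ v : T.V, v ∈ T.Vbad → Set (S.L.StarPacket v)) → ∀ (j : T.Label) (vQ : T.VQ), Set (S.L.Packet j vQ))
  (qK : ∀ v : T.V, v ∈ T.Vbad → Set (S.L.StarPacket v))
  {W : Type} {V : W → Type} [∀ w, TopologicalSpace (V w)] {TJ TM : Type} [TopologicalSpace TJ] [TopologicalSpace TM]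
  {C : ATS3.TensorPacketLociDatum W V TJ TM} {𝔇 : Dictionary S}

/-! ## 1. The reading datum (rows D-09, D-02): DATA ONLY -/

/-- **Reading of Joshi's theta-values loci in OUR packets** (DATA ONLY). `proj j vQ` = row D-09: the `(v_ℚ, j)`-factor of
Joshi's tensor codomain `𝓘^ℚ_Mochizuki = ∏_p ∏_{j=1}^{ℓ*} S_{j+1}𝓘^{ℚ_p}_p` ([J-III] (9.4.6.8) p.104 l.40–44, «[Mochizuki, 2021c,
Theorem 3.11(i)(c)]»; Rmk. 9.4.11.2 p.107 l.20–24 «[IUTchIII] Proposition 3.1 … 3.2») read as OUR tensor packet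
`𝓘^ℚ(^{S^±_{j+1}};^{n,∘}𝒟^⊢_{v_ℚ}) = S.L.Packet j vQ` (`S_{j+1} = Caps j`); `pt` = row D-02 concordance between the loci signature's
index type `C.Z = Σ̃_{L′}` and the seed dictionary's `𝔇.Pt = Σ̃_{L′}`, matching the standard points ([J-III] §4.5 p.36 l.11–17).
No property is asserted by this structure. [claim: Joshi2024ATS3, status: disputed] -/
structure LociReading (P : Cor312.Setting S.toSituation) (C : ATS3.TensorPacketLociDatum W V TJ TM) (𝔇 : Dictionary S) where
  /-- D-09: the `(v_ℚ, j)`-factor of `𝓘^ℚ_Mochizuki`, read in the packet `S.L.Packet j vQ` -/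
  proj : ∀ (j : T.Label) (vQ : T.VQ), TM → S.L.Packet j vQ
  /-- D-02: the Ansatz points of the two typings correspond -/
  pt : C.Z → 𝔇.Pt
  /-- … matching the standard point `z_Θ` (§4.5) with the seed's `std` -/
  pt_zTheta : pt C.zTheta = 𝔇.std

namespace LociReading

variable (R : LociReading P C 𝔇)

/-- **`Θ̃^{𝓘}_Mochizuki` read in the packet `(j, v_ℚ)`**: the image of Joshi's tensor locus (Thm-Def 9.8.1.1 (5)(6)) under the
D-09 reading. [claim: Joshi2024ATS3, status: disputed] -/
def locusRegion (j : T.Label) (vQ : T.VQ) : Set (S.L.Packet j vQ) := R.proj j vQ '' C.thetaLocusTensorM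

/-- The generators of `Ψ^{Mochizuki}_{Σ̃_{L′}}` coming from ONE Ansatz point `z` (all collation choices; Thm-Def 9.8.1.1 (1)(e)(f),
(5)) — a dot-notation extension of the loci signature (`Joshi/ThetaLociTensorPackets.lean`), declared here.
[claim: Joshi2024ATS3, status: disputed] -/
def _root_.Summit.ABC.IUTFork.Joshi.ATS3.TensorPacketLociDatum.generatorsAt
    (C : ATS3.TensorPacketLociDatum W V TJ TM) (z : C.Z) : Set C.ProdM :=
  {x | ∀ (i : Fin C.lstar) (a : Fin ((i : ℕ) + 2)) (w : W), ∃ ι ∈ C.coll (C.extAt z i a) w, x i a w = ι (C.xiM z i a w)}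

/-- `Ψ^{Mochizuki}` is the union over `z ∈ Σ̃_{L′}` of the generators at `z`. [folklore] -/
theorem _root_.Summit.ABC.IUTFork.Joshi.ATS3.TensorPacketLociDatum.psiM_eq_iUnion_generatorsAt
    (C : ATS3.TensorPacketLociDatum W V TJ TM) : C.psiM = ⋃ z : C.Z, C.generatorsAt z := by
  ext x
  simp only [ATS3.TensorPacketLociDatum.psiM, ATS3.TensorPacketLociDatum.generatorsAt, mem_setOf_eq, mem_iUnion]

/-- The generators at `z`, read in the packet `(j, v_ℚ)`. [claim: Joshi2024ATS3, status: disputed] -/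
def generatorRegion (z : C.Z) (j : T.Label) (vQ : T.VQ) : Set (S.L.Packet j vQ) :=
  R.proj j vQ '' (C.toTensorM '' C.generatorsAt z)

/-- Every generator region lies in the locus region (generators ⊆ convex closure). [folklore] -/
theorem generatorRegion_subset_locusRegion (z : C.Z) (j : T.Label) (vQ : T.VQ) :
    R.generatorRegion z j vQ ⊆ R.locusRegion j vQ := by
  refine image_mono (image_mono fun x hx => C.psiM_subset_thetaLocusProdM ?_)
  rw [C.psiM_eq_iUnion_generatorsAt]
  exact mem_iUnion.2 ⟨z, hx⟩

/-! ## 2. Row D-11: Joshi's locus versus the possible images and their hull (candidate hypotheses) -/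

/-- **D-11 (identification level, first half of print's «are»):** read in every packet, Joshi's `Θ̃^{𝓘}_Mochizuki` lies INSIDE
the union of the possible images of the Θ-pilot (the multiradial representation «subject to (Ind1), (Ind2), (Ind3)», Cor. 3.12
p.173 l.49 – p.174 l.3) — [J-III] Thm-Def 9.8.1.1 (7) p.116 l.43–50: the loci «are Mochizuki's multi-radial representations of
Theta-values i.e. the Theta-values locii of [Mochizuki, 2021c, Theorem 3.11, Corollary 3.12]». Candidate hypothesis asserted (as an
identification) in print; never asserted here. [claim: Joshi2024ATS3, status: disputed] -/
@[claim "Joshi2024ATS3" "disputed"]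
def LocusWithinPossibleImages : Prop := ∀ (j : T.Label) (vQ : T.VQ), R.locusRegion j vQ ⊆ ⋃₀ P.possibleImages j vQ

/-- **D-11 (identification level, second half of print's «are»):** conversely every possible image of the Θ-pilot is covered by
Joshi's locus read in the packet (same locator). Candidate hypothesis. [claim: Joshi2024ATS3, status: disputed] -/
@[claim "Joshi2024ATS3" "disputed"]
def PossibleImagesWithinLocus : Prop := ∀ (j : T.Label) (vQ : T.VQ), ⋃₀ P.possibleImages j vQ ⊆ R.locusRegion j vQ

/-- **D-11 (hull level):** read in every packet of a label in `𝔽_l^⋇`, Joshi's locus lies inside the holomorphic hull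
`^{n,∘}𝒰_{j,v_ℚ}` of the union of the possible images — the weakening of `LocusWithinPossibleImages` that (xi-f) consumes; Joshi's
comparison of his convex closure with Mochizuki's hull is Prop. 9.10.8.1 (p.126 l.22–55, slot T-23). Candidate hypothesis.
[claim: Joshi2024ATS3, status: disputed] -/
@[claim "Joshi2024ATS3" "disputed"]
def LocusWithinHull : Prop :=
  ∀ (i : Fin T.lstar) (vQ : T.VQ), R.locusRegion (Setting.labelSucc i) vQ ⊆ P.thetaHull (Setting.labelSucc i) vQ

/-- **OUR READING (D-03/D-06 ↔ D-09 concordance at the standard point):** the `ρ`-region of the seed's Kummer datum of the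
standard point `z_Θ` is read INSIDE Joshi's locus in every packet. Print home: `z_Θ ∈ Σ̃_{L′}` (§4.5 p.36 l.11–17), so
`log_BK(ξ^{Mochizuki}_{z_Θ}) ∈ Ψ^{Mochizuki} ⊂ Θ̃^{Ĩ}_Mochizuki` (Thm-Def 9.8.1.1 (5)) — the element the proofs of Thm. 9.9.1 / 9.11.1
exhibit (p.119 l.73–85, p.127 l.23–34); that its REGION reading is the datum's `ρ`-region is our dictionary gloss, not a printed
sentence. Candidate hypothesis, never asserted. -/
def StdDatumWithinLocus : Prop := ∀ (j : T.Label) (vQ : T.VQ), ρ (𝔇.datum 𝔇.std) j vQ ⊆ R.locusRegion j vQ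

/-- **OUR READING (D-03 ↔ D-09 concordance at every point):** the generators of Joshi's locus coming from `z`, read in the
packets, lie in the `ρ`-region of the seed's Kummer datum of the corresponding point `pt z` ([J-III] §6.10.1 p.53 «the elements
Ξ_z as Mochizuki's Θ-pilot objects»; Thm-Def 9.8.1.1 (1)(d)–(f)). Candidate hypothesis, never asserted. -/
def GeneratorsReadAsData : Prop :=
  ∀ (z : C.Z) (j : T.Label) (vQ : T.VQ), R.generatorRegion z j vQ ⊆ ρ (𝔇.datum (R.pt z)) j vQ

/-! ## 3. Glue (logic only; no Joshi claim and no clause of Cor. 3.12 is asserted) -/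

/-- Identification level ⟹ hull level: the hull contains the union of the possible images. [folklore] -/
theorem locusWithinHull_of_locusWithinPossibleImages (h : R.LocusWithinPossibleImages) : R.LocusWithinHull :=
  fun i vQ => (h (Setting.labelSucc i) vQ).trans ((P.frame _ vQ).subset_hull _)

/-- Print's «are» (both halves) pins the projected locus to the union of the possible images. [folklore] -/
theorem locusRegion_eq_of_both (h₁ : R.LocusWithinPossibleImages) (h₂ : R.PossibleImagesWithinLocus) (j : T.Label)
    (vQ : T.VQ) : R.locusRegion j vQ = ⋃₀ P.possibleImages j vQ :=
  (h₁ j vQ).antisymm (h₂ j vQ)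

/-- **Hull-level chain to the (xi-f) licence.** D-11 (hull) ∧ OUR READING `StdDatumWithinLocus` ∧ the seed's Y2
`StandardPointIsQPilot` (graded STRONGER-THAN-PRINT, E-PLAN R15 — the grade travels with every use) ∧ the q-pin (pq′) ⟹
`Thm311ToCor312.Licence P` («the q-pilot region lies in ^{n,∘}𝒰 at every label of 𝔽_l^⋇»). S-BYPASSING (hull level); logic only.
[claim: Joshi2024ATS3, status: disputed] -/
theorem licence_of_locusWithinHull (hL : R.LocusWithinHull) (hstd : R.StdDatumWithinLocus ρ)
    (hY2 : StandardPointIsQPilot ρ qK 𝔇) (hq : QPinned S P ρ qK) : Thm311ToCor312.Licence P := fun i vQ => by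
  rw [hq _ vQ, ← hY2 _ vQ]
  exact (hstd _ vQ).trans (hL i vQ)

/-- … hence the printed Statement of Cor. 3.12 under the bridge hypotheses (`Thm311ToCor312.statement_of_licence`). Reads:
«Statement follows from LocusWithinHull ∧ StdDatumWithinLocus ∧ StandardPointIsQPilot ∧ QPinned ∧ BridgeHyps» — nothing more.
[claim: Joshi2024ATS3, status: disputed] -/
theorem statement_of_locusWithinHull (H : BridgeHyps P) (hL : R.LocusWithinHull) (hstd : R.StdDatumWithinLocus ρ)
    (hY2 : StandardPointIsQPilot ρ qK 𝔇) (hq : QPinned S P ρ qK) : P.Statement :=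
  Thm311ToCor312.statement_of_licence H (R.licence_of_locusWithinHull ρ qK hL hstd hY2 hq)

/-- The same chain from the identification-level row. [claim: Joshi2024ATS3, status: disputed] -/
theorem statement_of_locusWithinPossibleImages (H : BridgeHyps P) (hL : R.LocusWithinPossibleImages)
    (hstd : R.StdDatumWithinLocus ρ) (hY2 : StandardPointIsQPilot ρ qK 𝔇) (hq : QPinned S P ρ qK) : P.Statement :=
  R.statement_of_locusWithinHull ρ qK H (R.locusWithinHull_of_locusWithinPossibleImages hL) hstd hY2 hq

/-- **What the identification-level row gives toward S, and no more:** a POINTWISE COVER of the q-pilot region by possible images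
(`qRegion ⊆ ⋃₀ possibleImages`) — weaker than `IndCoversQ` (one translate per packet, `Joshi/TestHarness.lean`) and than
S = `PilotKummerIndRelated` (ONE `D′ ∈ ^{n,∘}ℜ^LGP`, uniformly in `(j, v_ℚ)`). Logic only. [claim: Joshi2024ATS3, status: disputed] -/
theorem qRegion_subset_sUnion_possibleImages (hL : R.LocusWithinPossibleImages) (hstd : R.StdDatumWithinLocus ρ)
    (hY2 : StandardPointIsQPilot ρ qK 𝔇) (hq : QPinned S P ρ qK) (j : T.Label) (vQ : T.VQ) :
    P.qRegion j vQ ⊆ ⋃₀ P.possibleImages j vQ := by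
  rw [hq j vQ, ← hY2 j vQ]
  exact (hstd j vQ).trans (hL j vQ)

/-- **Volume form of the hull-level chain** (E-PLAN R9 shape SVB): D-11 (hull) ∧ `StdDatumWithinLocus` ∧ the seed's FAITHFUL size
form `StandardPointHasQPilotVolume` ∧ admissibility of the standard datum's regions ⟹ `SubsetVolumeBound P` (exhibit the
standard datum's region inside the hull and bound the q-contribution by its volume — the shape of [J-III] Thm. 9.11.1's proof,
p.127 l.41–55). Logic only. [claim: Joshi2024ATS3, status: disputed] -/
theorem subsetVolumeBound_of_locusWithinHull (hL : R.LocusWithinHull) (hstd : R.StdDatumWithinLocus ρ)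
    (hvol : StandardPointHasQPilotVolume ρ 𝔇 (P := P))
    (hadm : ∀ (i : Fin T.lstar) (vQ : T.VQ), (S.D P.n).Adm (Setting.labelSucc i) vQ (ρ (𝔇.datum 𝔇.std) _ vQ)) :
    SubsetVolumeBound P := fun i vQ =>
  ⟨ρ (𝔇.datum 𝔇.std) _ vQ, (hstd _ vQ).trans (hL i vQ), hadm i vQ, hvol _ vQ⟩

/-- … hence the printed Statement by the volume route (`statement_of_subsetVolumeBound`, `Joshi/TestHarness.lean`), WITHOUT
the STRONGER-THAN-PRINT `StandardPointIsQPilot`. Reads exactly: «Statement follows from LocusWithinHull ∧ StdDatumWithinLocus ∧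
StandardPointHasQPilotVolume ∧ admissibility ∧ BridgeHyps». [claim: Joshi2024ATS3, status: disputed] -/
theorem statement_of_locusWithinHull_vol (H : BridgeHyps P) (hL : R.LocusWithinHull) (hstd : R.StdDatumWithinLocus ρ)
    (hvol : StandardPointHasQPilotVolume ρ 𝔇 (P := P))
    (hadm : ∀ (i : Fin T.lstar) (vQ : T.VQ), (S.D P.n).Adm (Setting.labelSucc i) vQ (ρ (𝔇.datum 𝔇.std) _ vQ)) :
    P.Statement :=
  statement_of_subsetVolumeBound H (R.subsetVolumeBound_of_locusWithinHull ρ hL hstd hvol hadm)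

/-- The standard point's generators, read in the packets, lie in the locus region (no hypothesis: `z_Θ ∈ Σ̃_{L′}`). [folklore] -/
theorem generatorRegion_zTheta_subset (j : T.Label) (vQ : T.VQ) :
    R.generatorRegion C.zTheta j vQ ⊆ R.locusRegion j vQ :=
  R.generatorRegion_subset_locusRegion C.zTheta j vQ

/-- Under `GeneratorsReadAsData` the standard point's generators are read inside the standard datum's `ρ`-region (`pt z_Θ = std`);
`StdDatumWithinLocus` asks for the reverse containment of that region in the locus — the two readings bracket the datum. [folklore] -/
theorem generatorRegion_zTheta_subset_datum (h : R.GeneratorsReadAsData ρ) (j : T.Label) (vQ : T.VQ) :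
    R.generatorRegion C.zTheta j vQ ⊆ ρ (𝔇.datum 𝔇.std) j vQ := by
  rw [← R.pt_zTheta]
  exact h C.zTheta j vQ

end LociReading

end Summit.ABC.IUTFork.Joshi

end
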